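import Literature.Analysis.FluidPDE.CKNMorreyLemmas
import HarnessLib

/-!
# Hölder calculus for the parabolic Morrey condition `1_S h ∈ ℳ₂^{q,τ}`
(Lemarié-Rieusset 2016, §13.8 p. 462; §13.9 Steps 3–4, pp. 475–478)

Analysis/FluidPDE file in the decomposition of the named facts
`Literature.Analysis.FluidPDE.lemarieRieusset_ckn_criterion_qdep` /
`lemarieRieusset_ckn_criterion` (Lemarié-Rieusset 2016, Thm. 13.8, `CKNMorreyLemmas.lean` /
`CKNEpsilonRegularity.lean`). The printed proofs of Lemmas 13.5 and 13.6 (§13.9, Steps 3–4)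
place each term of the representation (13.50)–(13.52) of the localised velocity in a parabolic
Morrey space "by Hölder": e.g. p. 477, "`φ u·∇u ∈ ℳ₂^{6/5,ρ}` with `1/ρ = 1/τ₃ + 1/τ`",
"`1_{Q₂}|u|² belongs to ℳ₂^{3/2,γ}` with `1/γ = 1/τ₂ + 1/τ`"; p. 478, "`(∂ₜφ)u + (Δφ)u + φf`
belongs to `ℳ₂^{10/7,min(τ₀,τ₂)}`". This file **proves** that elementary calculus for the
accepted `IsParabolicMorreyOn S Φ q τ` (`∫∫_{Q*_r(z) ∩ S} Φ^q ≤ M r^{5(1-q/τ)}` for all centres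
`z` and radii `r > 0`, `CKNMorreyLemmas.lean`), so that the assemblies of Lemmas 13.5–13.6 from
their analytic inputs (parabolic Riesz potentials, Prop. 13.4) need not redo it:

* `IsParabolicMorreyOn.of_le`, `.const_mul`, `.add` — lattice and linear structure of `ℳ₂^{q,τ}`
  (sums with the quasi-triangle constant `LpAddConst` of `L^q`, any `q ≥ 0`);
* `isParabolicMorreyOn_self_of_setLIntegral_le` — `L^q(S) ⊆ ℳ₂^{q,q}`;
* `IsParabolicMorreyOn.of_integrability_le` — `ℳ₂^{q,τ} ⊆ ℳ₂^{p,τ}` for `0 < p ≤ q` (Hölder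
  against `1` on cylinders, `|Q*_r| = 2|B₁| r⁵`, `volume_parabolicCylinderCentered_rpow`);
* `IsParabolicMorreyOn.mul` — Hölder's inequality in parabolic Morrey spaces:
  `ℳ₂^{p₁,τ₁} · ℳ₂^{p₂,τ₂} ⊆ ℳ₂^{p,τ}` for `1/p = 1/p₁ + 1/p₂`, `1/τ = 1/τ₁ + 1/τ₂`, with constant
  `M₁^{p/p₁} M₂^{p/p₂}`.

Companion files (not duplicated here): the localisation of the Morrey condition to centres in the
cylinder and geometric radii (p. 462, (13.32)–(13.34)) is `CKNMorreyCovering.lean`; lowering the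
Morrey exponent `τ` on bounded sets is `IsParabolicMorreyOn.of_exponent_le`
(`CKNMorreyBootstrap.lean`). Nothing here is specific to Navier–Stokes; no definition is
introduced.

## References

* P. G. Lemarié-Rieusset, *The Navier–Stokes Problem in the 21st Century*, CRC Press (2016;
  held scan: 2nd ed.), §13.8, parabolic Morrey spaces `ℳ₂^{q,τ}` on the cylinders `Q_r(t,x)`,
  p. 462; §13.9 Step 3, proof of Lemma 13.5, pp. 475–477; Step 4, proof of Lemma 13.6, p. 478.
  [LemarieRieusset2016]
-/

noncomputable section

open MeasureTheory Set Function Filter Topology TopologicalSpace Metric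
open scoped NNReal ENNReal

namespace Literature.Analysis.FluidPDE

/-! ### Two remarks on centred parabolic cylinders -/

section Geometry

variable {X : Type*} [PseudoMetricSpace X]

/-- Membership in centred parabolic cylinders is symmetric: `w ∈ Q*_r(z) ↔ z ∈ Q*_r(w)`
(`|t - s| < r²` and `d(x, y) < r` are symmetric conditions). [folklore] -/
theorem mem_parabolicCylinderCentered_comm {r : ℝ} {z w : ℝ × X} :
    w ∈ FluidPDE.parabolicCylinderCentered r z ↔ z ∈ FluidPDE.parabolicCylinderCentered r w := by
  simp only [FluidPDE.mem_parabolicCylinderCentered, dist_comm]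
  constructor <;> rintro ⟨⟨h1, h2⟩, h3⟩ <;> exact ⟨⟨by linarith, by linarith⟩, h3⟩

/-- A centred cylinder with a point has positive radius. [folklore] -/
theorem pos_of_mem_parabolicCylinderCentered {r : ℝ} {z w : ℝ × X}
    (h : w ∈ FluidPDE.parabolicCylinderCentered r z) : 0 < r := by
  rw [FluidPDE.mem_parabolicCylinderCentered] at h
  exact lt_of_le_of_lt dist_nonneg h.2

end Geometry

/-! ### Elementary calculus of the Morrey condition -/

section Calculus

variable {S : Set (ℝ × EuclideanSpace ℝ (Fin 3))} {Φ Ψ : ℝ × EuclideanSpace ℝ (Fin 3) → ℝ≥0∞}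
  {q τ : ℝ}

/-- The Morrey condition passes to pointwise smaller sizes on `S` (`q ≥ 0`). [folklore] -/
theorem IsParabolicMorreyOn.of_le (h : IsParabolicMorreyOn S Φ q τ) (hS : MeasurableSet S)
    (hq : 0 ≤ q) (hle : ∀ w ∈ S, Ψ w ≤ Φ w) : IsParabolicMorreyOn S Ψ q τ := by
  obtain ⟨M, hM⟩ := h
  refine ⟨M, fun z r hr => le_trans ?_ (hM z r hr)⟩
  refine setLIntegral_mono'
    ((FluidPDE.isOpen_parabolicCylinderCentered r z).measurableSet.inter hS) ?_
  intro w hw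
  exact ENNReal.rpow_le_rpow (hle w hw.2) hq

/-- The Morrey condition is stable under multiplication by a finite constant (`q ≥ 0`):
`‖c h‖ = c ‖h‖` in `ℳ₂^{q,τ}`. [folklore] -/
theorem IsParabolicMorreyOn.const_mul (h : IsParabolicMorreyOn S Φ q τ) (hq : 0 ≤ q) {c : ℝ≥0∞}
    (hc : c ≠ ∞) : IsParabolicMorreyOn S (fun w => c * Φ w) q τ := by
  obtain ⟨M, hM⟩ := h
  have hcq : c ^ q ≠ ∞ := ENNReal.rpow_ne_top_of_nonneg hq hc
  refine ⟨(c ^ q).toNNReal * M, fun z r hr => ?_⟩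
  simp_rw [ENNReal.mul_rpow_of_nonneg _ _ hq]
  rw [lintegral_const_mul' _ _ hcq, ENNReal.coe_mul, ENNReal.coe_toNNReal hcq, mul_assoc]
  gcongr
  exact hM z r hr

/-- The Morrey condition is stable under sums (`q ≥ 0`): `ℳ₂^{q,τ}` is a vector space, with the
quasi-triangle constant of `L^q`. [folklore] -/
theorem IsParabolicMorreyOn.add (hΦ : IsParabolicMorreyOn S Φ q τ)
    (hΨ : IsParabolicMorreyOn S Ψ q τ) (hΦm : AEMeasurable Φ) (hq : 0 ≤ q) :
    IsParabolicMorreyOn S (fun w => Φ w + Ψ w) q τ := by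
  obtain ⟨M₁, h₁⟩ := hΦ
  obtain ⟨M₂, h₂⟩ := hΨ
  set C : ℝ≥0∞ := ENNReal.LpAddConst (ENNReal.ofReal q)⁻¹ with hC
  have hCfin : C ≠ ∞ := (ENNReal.LpAddConst_lt_top _).ne
  refine ⟨C.toNNReal * (M₁ + M₂), fun z r hr => ?_⟩
  calc ∫⁻ w in FluidPDE.parabolicCylinderCentered r z ∩ S, (Φ w + Ψ w) ^ q
      ≤ ∫⁻ w in FluidPDE.parabolicCylinderCentered r z ∩ S, C * (Φ w ^ q + Ψ w ^ q) :=
        lintegral_mono fun w => by rw [hC]; exact ENNReal.rpow_add_le_mul_rpow_add_rpow' _ _ hq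
    _ = C * ((∫⁻ w in FluidPDE.parabolicCylinderCentered r z ∩ S, Φ w ^ q) +
          ∫⁻ w in FluidPDE.parabolicCylinderCentered r z ∩ S, Ψ w ^ q) := by
        rw [lintegral_const_mul' _ _ hCfin, lintegral_add_left' (hΦm.restrict.pow_const q)]
    _ ≤ C * (M₁ * ENNReal.ofReal (r ^ (5 * (1 - q / τ))) +
          M₂ * ENNReal.ofReal (r ^ (5 * (1 - q / τ)))) := by
        gcongr
        · exact h₁ z r hr
        · exact h₂ z r hr
    _ = ↑(C.toNNReal * (M₁ + M₂)) * ENNReal.ofReal (r ^ (5 * (1 - q / τ))) := by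
        rw [ENNReal.coe_mul, ENNReal.coe_toNNReal hCfin, ENNReal.coe_add]; ring

/-- **`L^q ⊆ ℳ₂^{q,q}`**: a finite total mass `∫∫_S |h|^q ≤ M` is the Morrey condition with
`τ = q` (exponent `5(1 - q/q) = 0`). [folklore] -/
theorem isParabolicMorreyOn_self_of_setLIntegral_le {M : ℝ≥0} (hq : q ≠ 0)
    (h : ∫⁻ w in S, Φ w ^ q ≤ M) : IsParabolicMorreyOn S Φ q q := by
  refine ⟨M, fun z r _ => ?_⟩
  rw [div_self hq, sub_self, mul_zero, Real.rpow_zero, ENNReal.ofReal_one, mul_one]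
  exact (lintegral_mono_set inter_subset_right).trans h

/-- The volume of a centred cylinder as `(2|B₁|) r⁵` with a real power. [folklore] -/
theorem volume_parabolicCylinderCentered_rpow {r : ℝ} (hr : 0 < r)
    (z : ℝ × EuclideanSpace ℝ (Fin 3)) :
    volume (FluidPDE.parabolicCylinderCentered r z) =
      2 * volume (ball (0 : EuclideanSpace ℝ (Fin 3)) 1) * ENNReal.ofReal (r ^ (5 : ℝ)) := by
  have h5 : r ^ (5 : ℝ) = r ^ (5 : ℕ) := by rw [← Real.rpow_natCast]; norm_num
  rw [volume_parabolicCylinderCentered hr z, ENNReal.ofReal_mul (by norm_num : (0 : ℝ) ≤ 2),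
    ENNReal.ofReal_ofNat, h5]
  ring

/-- **Monotonicity in the integrability exponent** (Hölder against `1` on cylinders,
`|Q*_r| = 2|B₁| r⁵`): `ℳ₂^{q,τ} ⊆ ℳ₂^{p,τ}` for `0 < p ≤ q`, i.e.
`∫∫_{Q*_r ∩ S} Φ^p ≤ (∫∫_{Q*_r ∩ S} Φ^q)^{p/q} |Q*_r|^{1-p/q} ≤ C r^{5(1 - p/τ)}`. [folklore] -/
theorem IsParabolicMorreyOn.of_integrability_le {p : ℝ} (h : IsParabolicMorreyOn S Φ q τ)
    (hΦ : AEMeasurable Φ) (hp : 0 < p) (hpq : p ≤ q) : IsParabolicMorreyOn S Φ p τ := by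
  rcases hpq.eq_or_lt with rfl | hpq
  · exact h
  obtain ⟨M, hM⟩ := h
  have hq : 0 < q := hp.trans hpq
  set θ : ℝ := 1 - p / q with hθ
  have hθ0 : 0 < θ := by rw [hθ, sub_pos, div_lt_one hq]; exact hpq
  set V : ℝ≥0∞ := 2 * volume (ball (0 : EuclideanSpace ℝ (Fin 3)) 1) with hV
  have hVfin : V ≠ ∞ := ENNReal.mul_ne_top (by simp) measure_ball_lt_top.ne
  set K : ℝ≥0∞ := (M : ℝ≥0∞) ^ (p / q) * V ^ θ with hK
  have hKfin : K ≠ ∞ :=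
    ENNReal.mul_ne_top (ENNReal.rpow_ne_top_of_nonneg (by positivity) ENNReal.coe_ne_top)
      (ENNReal.rpow_ne_top_of_nonneg hθ0.le hVfin)
  refine ⟨K.toNNReal, fun z r hr => ?_⟩
  rw [ENNReal.coe_toNNReal hKfin]
  have H := setLIntegral_rpow_le_rpow_mul_measure volume
    (FluidPDE.parabolicCylinderCentered r z ∩ S) (F := Φ) hΦ.restrict hp hpq
  refine H.trans ?_
  have h1 : (∫⁻ w in FluidPDE.parabolicCylinderCentered r z ∩ S, Φ w ^ q) ^ (p / q) ≤
      (M : ℝ≥0∞) ^ (p / q) * ENNReal.ofReal (r ^ (5 * (1 - q / τ) * (p / q))) := by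
    calc _ ≤ ((M : ℝ≥0∞) * ENNReal.ofReal (r ^ (5 * (1 - q / τ)))) ^ (p / q) :=
          ENNReal.rpow_le_rpow (hM z r hr) (by positivity)
      _ = _ := by
          rw [ENNReal.mul_rpow_of_nonneg _ _ (by positivity),
            ENNReal.ofReal_rpow_of_nonneg (by positivity) (by positivity), ← Real.rpow_mul hr.le]
  have h2 : volume (FluidPDE.parabolicCylinderCentered r z ∩ S) ^ (1 - p / q) ≤
      V ^ θ * ENNReal.ofReal (r ^ (5 * θ)) := by
    calc _ ≤ volume (FluidPDE.parabolicCylinderCentered r z) ^ θ :=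
          ENNReal.rpow_le_rpow (measure_mono inter_subset_left) hθ0.le
      _ = (V * ENNReal.ofReal (r ^ (5 : ℝ))) ^ θ := by
          rw [volume_parabolicCylinderCentered_rpow hr, hV]
      _ = V ^ θ * ENNReal.ofReal (r ^ (5 * θ)) := by
          rw [ENNReal.mul_rpow_of_nonneg _ _ hθ0.le,
            ENNReal.ofReal_rpow_of_nonneg (by positivity) hθ0.le, ← Real.rpow_mul hr.le]
  calc (∫⁻ w in FluidPDE.parabolicCylinderCentered r z ∩ S, Φ w ^ q) ^ (p / q) *
        volume (FluidPDE.parabolicCylinderCentered r z ∩ S) ^ (1 - p / q)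
      ≤ ((M : ℝ≥0∞) ^ (p / q) * ENNReal.ofReal (r ^ (5 * (1 - q / τ) * (p / q)))) *
          (V ^ θ * ENNReal.ofReal (r ^ (5 * θ))) := mul_le_mul' h1 h2
    _ = K * ENNReal.ofReal (r ^ (5 * (1 - p / τ))) := by
        rw [hK, mul_mul_mul_comm, ← ENNReal.ofReal_mul (by positivity), ← Real.rpow_add hr]
        congr 3
        rw [hθ]; field_simp; ring

/-- **Hölder's inequality in parabolic Morrey spaces**: if `1_S Φ ∈ ℳ₂^{p₁,τ₁}` and
`1_S Ψ ∈ ℳ₂^{p₂,τ₂}` with `1/p = 1/p₁ + 1/p₂` and `1/τ = 1/τ₁ + 1/τ₂` (written `p/τ = p/τ₁ + p/τ₂`),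
then `1_S ΦΨ ∈ ℳ₂^{p,τ}`:
`∫∫_{Q*_r ∩ S} (ΦΨ)^p ≤ (∫∫ Φ^{p₁})^{p/p₁} (∫∫ Ψ^{p₂})^{p/p₂} ≤ M₁^{p/p₁} M₂^{p/p₂} r^{5(1-p/τ)}`
(the bookkeeping of Lemarié-Rieusset 2016, pp. 475–478, e.g. "`φ u·∇u ∈ ℳ₂^{6/5,ρ}` with
`1/ρ = 1/τ₃ + 1/τ`"). [folklore] -/
theorem IsParabolicMorreyOn.mul {p₁ p₂ p τ₁ τ₂ : ℝ} (hΦ : IsParabolicMorreyOn S Φ p₁ τ₁)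
    (hΨ : IsParabolicMorreyOn S Ψ p₂ τ₂) (hΦm : AEMeasurable Φ) (hΨm : AEMeasurable Ψ)
    (hp : p₁.HolderTriple p₂ p) (hτ : p / τ = p / τ₁ + p / τ₂) :
    IsParabolicMorreyOn S (fun w => Φ w * Ψ w) p τ := by
  obtain ⟨M₁, h₁⟩ := hΦ
  obtain ⟨M₂, h₂⟩ := hΨ
  have hp0 : 0 < p := hp.pos'
  have hp₁ : 0 < p₁ := hp.pos
  have hp₂ : 0 < p₂ := hp.symm.pos
  have hconj : (p₁ / p).HolderConjugate (p₂ / p) := hp.holderConjugate_div_div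
  have hsum : p / p₁ + p / p₂ = 1 := by
    rw [div_eq_mul_inv, div_eq_mul_inv, ← mul_add, hp.inv_add_inv_eq_inv, mul_inv_cancel₀ hp0.ne']
  refine ⟨M₁ ^ (p / p₁) * M₂ ^ (p / p₂), fun z r hr => ?_⟩
  set μ : Measure (ℝ × EuclideanSpace ℝ (Fin 3)) :=
    volume.restrict (FluidPDE.parabolicCylinderCentered r z ∩ S) with hμ
  have H := ENNReal.lintegral_mul_le_Lp_mul_Lq μ hconj (hΦm.restrict.pow_const p)
    (hΨm.restrict.pow_const p)
  have e1 : ∀ w, (Φ w ^ p) ^ (p₁ / p) = Φ w ^ p₁ := fun w => by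
    rw [← ENNReal.rpow_mul, mul_div_cancel₀ _ hp0.ne']
  have e2 : ∀ w, (Ψ w ^ p) ^ (p₂ / p) = Ψ w ^ p₂ := fun w => by
    rw [← ENNReal.rpow_mul, mul_div_cancel₀ _ hp0.ne']
  simp only [Pi.mul_apply, e1, e2, one_div_div] at H
  calc ∫⁻ w in FluidPDE.parabolicCylinderCentered r z ∩ S, (Φ w * Ψ w) ^ p
      = ∫⁻ w in FluidPDE.parabolicCylinderCentered r z ∩ S, Φ w ^ p * Ψ w ^ p := by
        simp_rw [ENNReal.mul_rpow_of_nonneg _ _ hp0.le]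
    _ ≤ (∫⁻ w in FluidPDE.parabolicCylinderCentered r z ∩ S, Φ w ^ p₁) ^ (p / p₁) *
          (∫⁻ w in FluidPDE.parabolicCylinderCentered r z ∩ S, Ψ w ^ p₂) ^ (p / p₂) := H
    _ ≤ ((M₁ : ℝ≥0∞) * ENNReal.ofReal (r ^ (5 * (1 - p₁ / τ₁)))) ^ (p / p₁) *
          ((M₂ : ℝ≥0∞) * ENNReal.ofReal (r ^ (5 * (1 - p₂ / τ₂)))) ^ (p / p₂) := by
        gcongr
        · exact h₁ z r hr
        · exact h₂ z r hr
    _ = ↑(M₁ ^ (p / p₁) * M₂ ^ (p / p₂)) * ENNReal.ofReal (r ^ (5 * (1 - p / τ))) := by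
        rw [ENNReal.mul_rpow_of_nonneg _ _ (by positivity),
          ENNReal.mul_rpow_of_nonneg _ _ (by positivity),
          ENNReal.ofReal_rpow_of_nonneg (by positivity) (by positivity),
          ENNReal.ofReal_rpow_of_nonneg (by positivity) (by positivity), ← Real.rpow_mul hr.le,
          ← Real.rpow_mul hr.le, mul_mul_mul_comm, ← ENNReal.ofReal_mul (by positivity),
          ← Real.rpow_add hr, ENNReal.coe_mul, ENNReal.coe_rpow_of_nonneg _ (by positivity),
          ENNReal.coe_rpow_of_nonneg _ (by positivity)]
        congr 2
        have : 5 * (1 - p₁ / τ₁) * (p / p₁) + 5 * (1 - p₂ / τ₂) * (p / p₂) =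
            5 * ((p / p₁ + p / p₂) - (p / τ₁ + p / τ₂)) := by
          field_simp; ring
        rw [this, hsum, ← hτ]

end Calculus

end Literature.Analysis.FluidPDE
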